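import Summits.PneNP.PneNP.Theorems.OneSliceConstantBandNearCliqueContiguity
import Summits.PneNP.PneNP.Theorems.OneSliceConstantBandRelMintermStep
import Summits.PneNP.PneNP.Theorems.OneSliceConstantBandOfAdvSparse

/-!
# Route OneSlice, crux `ConstantBand` (stmt-PneNP-2834), line `flat-prior-relative-minterms`:
# the reduction of the crux to its engine, as importable tree theorems

The line `flat-prior-relative-minterms` proves the crux `Summit.PneNP.PneNP.Theses.OneSlice.ConstantBand` from five
obligations; four of them are LANDED theorems of the tree (`stub_sliceLemma23`, `stub_nearCliqueContiguity`,
`stub_relMintermStep`, `stub_transferStep`) and the fifth — the engine `RelMintermSparse` ("size-`n^c` monotone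
circuits have relative clique-minterm density `< 1/2` under the band law"), equivalently its distinguishing form
`AdvSparse` ("… have planted-`k`-clique detection advantage `< 1/2` on the critical lower band") — is OPEN
(crux-sized: an FPT average-case planted-clique distinguisher lower bound for monotone circuits at the appearance
threshold; see `Cruxes/ConstantBand/Lines/flat-prior-relative-minterms.lean` and the lead's census). The
advantage-form reduction `fprm_constantBand_of_advSparse : AdvSparse → ConstantBand` is
`OneSliceConstantBandOfAdvSparse.lean`; this file assembles ALL FOUR landed stubs into the minterm-form
CONDITIONAL theorem

* `fprm_constantBand_of_relMintermSparse : RelMintermSparse → ConstantBand`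

(the skeleton's composition `ConstantBand_of` with its `bandPair_of`, made importable), so that whichever form of
the engine is proved later closes the crux by a one-line application. Conditional in the sense of D-0014
(hypothesis = an open statement of the line, not a Literature fact); it closes nothing by itself.
-/

set_option linter.dupNamespace false

namespace Summit.PneNP.PneNP.Cruxes.ConstantBand.FlatPriorRelativeMinterms

open Literature.Computability.Complexity Finset Filter Classical
open Summit.PneNP.PneNP.Theses.OneSlice (ConstantBand)

/-- For `C(k,2) ≤ w` the centre `j` lies in the lower band, so the lower band is non-empty. -/
theorem fprm_mem_lowerBand_self {k j w : ℕ} (hw : k.choose 2 ≤ w) : j ∈ lowerBand k j w := by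
  simp only [lowerBand, mem_Icc]
  omega

/-- **BandPair from the brick and the engine** (the skeleton's `bandPair_of`). Given `c`, the engine supplies `k`,
`ρ < 1/2`, `w₁`; put `γ := (1/2 − ρ)/4`, take `w₀` from `RelMintermPlanted` and `w := max (max w₀ w₁) C(k,2)`. A small
monotone `C` accepting all but `γ` of the planted pairs yet rejecting half the band would have relative-minterm
density `≥ 1/2 − 2γ = 1/4 + ρ/2 > ρ` on a non-empty lower band — contradiction. -/
theorem fprm_bandPair_of : RelMintermPlanted → RelMintermSparse → BandPair := by
  intro hR hS c
  obtain ⟨k, hk, ρ, hρ, w₁, hSw⟩ := hS c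
  have hγ0 : 0 < (1 / 2 - ρ) / 4 := by linarith
  obtain ⟨w₀, hRw⟩ := hR k hk ((1 / 2 - ρ) / 4) hγ0
  have hw₀ : w₀ ≤ max (max w₀ w₁) (k.choose 2) := le_trans (le_max_left _ _) (le_max_left _ _)
  have hw₁ : w₁ ≤ max (max w₀ w₁) (k.choose 2) := le_trans (le_max_right _ _) (le_max_left _ _)
  have hwk : k.choose 2 ≤ max (max w₀ w₁) (k.choose 2) := le_max_right _ _
  refine ⟨k, hk, max (max w₀ w₁) (k.choose 2), (1 / 2 - ρ) / 4, hγ0, ?_⟩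
  filter_upwards [hRw _ hw₀, hSw _ hw₁] with n hRn hSn
  intro j hj C hC hsize hplanted
  by_contra hband
  push Not at hband
  have hmono : Monotone C.eval := C.monotone_eval_of_isOver_monotoneBasis hC
  have h1 := hRn j hj C.eval hmono hplanted hband
  have h2 := hSn j hj C hC hsize
  have hL : (1 : ℝ) ≤ #(lowerBand k j (max (max w₀ w₁) (k.choose 2))) := by
    have : 1 ≤ #(lowerBand k j (max (max w₀ w₁) (k.choose 2))) :=
      card_pos.2 ⟨j, fprm_mem_lowerBand_self hwk⟩
    exact_mod_cast this
  have h3 := h1.trans h2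
  nlinarith [mul_pos (by linarith : (0 : ℝ) < 1 / 4 - ρ / 2)
    (by linarith : (0 : ℝ) < #(lowerBand k j (max (max w₀ w₁) (k.choose 2))))]

/-- **The crux from the engine (minterm form).** `RelMintermSparse → ConstantBand`: the line's composition
`ConstantBand_of` with the four landed stubs plugged in. CONDITIONAL on the open engine. -/
theorem fprm_constantBand_of_relMintermSparse : RelMintermSparse → ConstantBand :=
  fun hS => constantBand_iff.2
    (stub_transferStep stub_sliceLemma23 (fprm_bandPair_of (stub_relMintermStep stub_nearCliqueContiguity) hS))

end Summit.PneNP.PneNP.Cruxes.ConstantBand.FlatPriorRelativeMinterms
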